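import Summits.ABC.IUTFork.Repair.CandJoshi23Price
import HarnessLib

/-!
# IUT REPAIR BRANCH (LADDER-ABC:A2.RP), class (iii) JOSHI, j2 — «VAL(U)»: the VALUE CHART over an ARBITRARY scalar group `U`
# (the model of `Repair/CandJoshi23` with the indeterminacy scalars a PARAMETER), I: data, typed Thm. 3.11, setting, pins

Record file of the abc-iut cell's IUT REPAIR BRANCH (seat abc-iut-rp-j2, gen 3; row RP-J05 door (a) — price SCHEMA; sequel to
`Repair/CandJoshi23` p437744, `CandJoshi23Tests` p438692, `CandJoshi23Price` p439085/p440622). TAKES NO SIDE on [IUTchIII] Cor. 3.12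
or on any author. MODEL DATA only (toy, over abc-iut-c312-7's one-place `toyIndex`, `l⋇ = 2`); no `Prop` fact; nothing about the
intended objects of [IUTchIII] or of K. Joshi's theory is asserted; typed ≠ proved ≠ endorsed.

WHAT AND WHY. `CandJoshi23` typed Joshi's valuation law «`v_{K_j}(p) = j²·v_{K_1}(p)`», «`|z|_{K_j} = |z|^{j²}_{K_1}`» (arXiv:2303.01662
Thm. 6.9.1 (1) p. 17 l. 49–50, (3) l. 52–53; (9.2.3) p. 27 l. 66–75) ℚ-LINEARLY on the VALUE LINE `ord(−) ⊗ ℚ`, with abc-iut-w4-d098's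
scalar shells `scalarShells p U` at the ONE group `U :=` all positive rationals, and found (p439085): door (a) supplies S, the Θ-hull is
the scale-invariant unit shell, `−|log(Θ)| = 0`, the typed Statement TRUE and idle. THIS FILE makes the scalar group a PARAMETER:
for EVERY subgroup `U ≤ ℚˣ` it builds the same value chart (§1 order half-lines `H_a = {v ≥ a}` = chart of `q^a·𝒪`, `μ(H_a) = −a·log p`;
§2 data (a)(b)(c), column, full situation, **`uFull_statement`: the typed Thm. 3.11 (i) ∧ (ii) ∧ (iii) HOLDS for every `U`**; §3 hull
frame and the HONEST setting `Θ ↦ H_{j²}`, `q ↦ H_1`; §4 the reading `uRho` «`X ↦ {v ≥ X_j}`», EQUIVARIANT under all of `⟨(Ind1)∪(Ind2)⟩`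
and **the THREE PINS, for every `U` inside the positive rationals**). The sequel `CandJoshi24Schema` proves the SCHEMA over `U`:
S ⟺ `¼ ∈ U`; Step (x) log-volume invariance ⟺ `U = ⊥`; `U = ⊥` ⟹ honest hull, Statement FALSE; `U ≠ ⊥` ⟹ hull = unit shell,
`−|log(Θ)| = 0`, ThetaFinite ∧ BridgeHyps ∧ Statement TRUE — whether or not S holds. HONEST SCOPE: interface-level; the chart
identifies a log-shell packet with its value line, which [IUTchIII] does not do ((Ind1)/(Ind2) are isometries, Step (x) p. 181 l. 5–13);
the model prices Joshi's law as printed, it does not read [IUTchIII]. [claim: Mochizuki2012, status: disputed]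
[claim: Joshi2023ATS2Local, status: disputed]
-/


noncomputable section

open Set

namespace Summit.ABC.IUTFork.Repair.CandJoshi24

open Thm311 Cor312 Cor312.Checks Cor312.IdentifiedNonVacuity Cor312Vol Cor312Vol.NaiveWitness Cor312Vol.PinnedWitness
  Literature.IUT.LogThetaLattice Summit.ABC.IUTFork.Repair Summit.ABC.IUTFork.Repair.ScalarShells
  Summit.ABC.IUTFork.Repair.ScalarShellsThm311

variable (p : ℕ) (U : Subgroup ℚˣ)

/-! ## 1. The value chart over `U`: order half-lines, their log-volume, scaling transport -/

/-- **The VALUE-CHART shells over the scalar group `U`**: abc-iut-w4-d098's `scalarShells p U` — carrier `ℚ` READ AS THE VALUE LINE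
`ord(−) ⊗ ℚ` of a bad place, strip-automorphisms and "Ism" the scalings `v ↦ u·v`, `u ∈ U` (`CandJoshi23.valShells` is the instance
`U = Units.posSubgroup ℚ`). [claim: Joshi2023ATS2Local, status: disputed] -/
abbrev uShells : LogShells toyIndex := scalarShells p U

/-- The ORDER HALF-LINE `H_a := {x | a ≤ line x}` of the packet line at `(j, v_ℚ)` — the value chart of the ball `q^a·𝒪`. [folklore] -/
def uHalf (j : toyIndex.Label) (vQ : toyIndex.VQ) (a : ℚ) : Set ((uShells p U).Packet j vQ) := {x | a ≤ line j vQ x}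

variable {p U} in
/-- Membership in a half-line. [folklore] -/
theorem mem_uHalf {j : toyIndex.Label} {vQ : toyIndex.VQ} {a : ℚ} {x : (uShells p U).Packet j vQ} :
    x ∈ uHalf p U j vQ a ↔ a ≤ line j vQ x := Iff.rfl

/-- The point of the packet line with coordinate `a`. [folklore] -/
def uPt (j : toyIndex.Label) (vQ : toyIndex.VQ) (a : ℚ) : (uShells p U).Packet j vQ := (line j vQ).symm a

/-- Its coordinate is `a`. [folklore] -/
theorem line_uPt (j : toyIndex.Label) (vQ : toyIndex.VQ) (a : ℚ) : line j vQ (uPt p U j vQ a) = a :=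
  LinearEquiv.apply_symm_apply _ _

/-- `uPt a ∈ H_a`. [folklore] -/
theorem uPt_mem_uHalf (j : toyIndex.Label) (vQ : toyIndex.VQ) (a : ℚ) : uPt p U j vQ a ∈ uHalf p U j vQ a := by
  rw [mem_uHalf, line_uPt]

/-- Half-lines are ANTITONE in the threshold: `a ≤ b ⟹ H_b ⊆ H_a`. [folklore] -/
theorem uHalf_anti {j : toyIndex.Label} {vQ : toyIndex.VQ} {a b : ℚ} (h : a ≤ b) : uHalf p U j vQ b ⊆ uHalf p U j vQ a :=
  fun _ hx => le_trans h hx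

/-- … and conversely: `H_b ⊆ H_a ⟹ a ≤ b`. [folklore] -/
theorem le_of_uHalf_subset {j : toyIndex.Label} {vQ : toyIndex.VQ} {a b : ℚ} (h : uHalf p U j vQ b ⊆ uHalf p U j vQ a) :
    a ≤ b := by
  have hb := h (uPt_mem_uHalf p U j vQ b)
  rwa [mem_uHalf, line_uPt] at hb

/-- `H_a = H_b ⟺ a = b`. [folklore] -/
theorem uHalf_eq_iff {j : toyIndex.Label} {vQ : toyIndex.VQ} {a b : ℚ} : uHalf p U j vQ a = uHalf p U j vQ b ↔ a = b :=
  ⟨fun h => le_antisymm (le_of_uHalf_subset p U h.symm.subset) (le_of_uHalf_subset p U h.subset), fun h => h ▸ rfl⟩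

open scoped Classical in
/-- **The log-volume of the value chart**: `μ(H_a) := −a·log p` (the `p`-adic log-volume of `q^a·𝒪`, `q := p`), `0` on non-half-lines
(never read). [claim: Mochizuki2012, status: disputed] -/
def uVol (j : toyIndex.Label) (vQ : toyIndex.VQ) (A : Set ((uShells p U).Packet j vQ)) : ℝ :=
  if h : ∃ a : ℚ, A = uHalf p U j vQ a then -((Classical.choose h : ℚ) : ℝ) * Real.log p else 0

/-- `μ(H_a) = −a·log p`. [folklore] -/
theorem uVol_uHalf (j : toyIndex.Label) (vQ : toyIndex.VQ) (a : ℚ) : uVol p U j vQ (uHalf p U j vQ a) = -(a : ℝ) * Real.log p := by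
  have h : ∃ b : ℚ, uHalf p U j vQ a = uHalf p U j vQ b := ⟨a, rfl⟩
  unfold uVol
  rw [dif_pos h, ← (uHalf_eq_iff p U).1 (Classical.choose_spec h)]

/-- **SCALING TRANSPORT**: a packet automorphism acting on the line by a POSITIVE scalar `u` maps `H_a` ONTO `H_{u·a}` (the valuation
law `v ↦ u·v` applied to the ball `{v ≥ a}`). [folklore] -/
theorem image_uHalf_of_line_eq {j : toyIndex.Label} {vQ : toyIndex.VQ}
    (Φ : (uShells p U).Packet j vQ ≃ₗ[ℚ] (uShells p U).Packet j vQ) {u : ℚ} (hu : 0 < u)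
    (hΦ : ∀ x, line j vQ (Φ x) = u * line j vQ x) (a : ℚ) : Φ '' uHalf p U j vQ a = uHalf p U j vQ (u * a) := by
  apply Set.Subset.antisymm
  · rintro _ ⟨x, hx, rfl⟩
    rw [mem_uHalf, hΦ]
    exact mul_le_mul_of_nonneg_left hx hu.le
  · intro y hy
    refine ⟨Φ.symm y, ?_, LinearEquiv.apply_symm_apply _ _⟩
    have h1 := hΦ (Φ.symm y)
    rw [LinearEquiv.apply_symm_apply] at h1
    rw [mem_uHalf, h1] at hy
    exact le_of_mul_le_mul_left hy hu

/-! ## 2. The data (a)(b)(c), the situation, the column, the full situation; the typed Theorem 3.11 holds for every `U` -/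

/-- **The Θ-side Kummer datum in the value chart**: the valuation tuple `(j²)_{j ∈ 𝔽_l^⋇}` of the Θ-values `q^{j²}`.
[claim: Mochizuki2012, status: disputed] -/
def uPsi (v : toyIndex.V) : Set ((uShells p U).StarPacket v) :=
  {ψ | ∀ j : toyIndex.LabelStar, line j.1 (toyIndex.over v) (ψ j) = (jsq j.1 : ℚ)}

/-- **The q-pilot's Kummer datum in the value chart**: the valuation tuple `(1)_{j ∈ 𝔽_l^⋇}` of `q`. [claim: Mochizuki2012, status: disputed] -/
def uQDatum : ∀ v : toyIndex.V, v ∈ toyIndex.Vbad → Set ((uShells p U).StarPacket v) := fun v _ =>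
  {ψ | ∀ j : toyIndex.LabelStar, line j.1 (toyIndex.over v) (ψ j) = 1}

/-- The Θ-tuple `(j²)_j` itself. [folklore] -/
def uThetaTuple (vQ : toyIndex.VQ) : (uShells p U).StarPacket vQ := fun j => uPt p U j.1 vQ (jsq j.1 : ℚ)

/-- It lies in `uPsi`. [folklore] -/
theorem uThetaTuple_mem (vQ : toyIndex.VQ) : uThetaTuple p U vQ ∈ uPsi p U vQ := fun j => line_uPt p U j.1 vQ _

/-- The q-tuple `(1)_j` itself. [folklore] -/
def uQTuple (vQ : toyIndex.VQ) : (uShells p U).StarPacket vQ := fun j => uPt p U j.1 vQ 1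

/-- It lies in `uQDatum`. [folklore] -/
theorem uQTuple_mem (vQ : toyIndex.VQ) : uQTuple p U vQ ∈ uQDatum p U vQ (Set.mem_univ _) := fun j => line_uPt p U j.1 vQ _

/-- **The data (a)(b)(c) of every vertical line in the value chart over `U`** ([IUTchIII] Thm. 3.11 (i)): integral structures the unit
shell `H_0`, admissible regions the half-lines, log-volume `μ(H_a) = −a·log p`, splitting monoid the Θ-tuple, number-field copy the
global packet. [claim: Mochizuki2012, status: disputed] -/
def uData : MRData (uShells p U) where
  shellPk := fun j vQ => uHalf p U j vQ 0
  shellSub := fun j v => uHalf p U j (toyIndex.over v) 0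
  Adm := fun j vQ A => ∃ a : ℚ, A = uHalf p U j vQ a
  logvol := fun j vQ A => uVol p U j vQ A
  Ψ := fun v _ => uPsi p U v
  act := fun v _ y => LinearMap.pi fun j => (line j.1 (toyIndex.over v) (y j)) • LinearMap.proj j
  Mmod := fun _ => Set.univ

/-- **(c)'s global realified Frobenioids in the value chart**: objects `q^a·𝒪` (`a ∈ ℚ`), degree `−a·log p`, region `H_a`.
[claim: Mochizuki2012, status: disputed] -/
def uDegrees (j : toyIndex.LabelStar) : GlobalDegrees (uShells p U) j where
  ObjMOD := ℚ
  Objmod := ℚ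
  natIso := Equiv.refl ℚ
  deg := fun a => -(a : ℝ) * Real.log p
  region := fun a vQ => uHalf p U j.1 vQ a

/-- **The value-chart situation over `U`**: `uData` on every vertical line (an `abbrev`). [claim: Mochizuki2012, status: disputed] -/
abbrev uSituation : Situation toyIndex where
  L := uShells p U
  D := fun _ => uData p U
  G := fun _ j => uDegrees p U j

/-- **The column** ([IUTchIII] Thm. 3.11 (ii)): Kummer transport the identity at every `(n, m)`, unit-group images `H_{m'+1}`, Frobenioid
objects tagged copies of `ℤ`, Θ-pilot the object of index `1` (as `CandJoshi23.vColumn`). [claim: Mochizuki2012, status: disputed] -/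
def uColumn : Column (uShells p U) where
  frobAdm := fun _ j vQ A => ∃ a : ℚ, A = uHalf p U j vQ a
  frobLogvol := fun _ j vQ A => uVol p U j vQ A
  frobΨ := fun _ v _ => uPsi p U v
  frobMmod := fun _ _ => Set.univ
  unitImage := fun _ m' j vQ => uHalf p U j vQ ((m' : ℚ) + 1)
  ballImage := fun _ j vQ => uHalf p U j vQ 0
  ObjLGP := ℤ
  frobObjLGP := FrobObj
  kumLGP := kum
  ObjLgp := ℤ
  frobObjLgp := FrobObj
  kumLgp := kum
  thetaPilot := fun m => ⟨(1, m), rfl⟩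

/-- **The full situation of [IUTchIII] Thm. 3.11 in the value chart over `U`** (link data: abc-iut-w5-d247's `naiveLink`). An `abbrev`.
[claim: Mochizuki2012, status: disputed] -/
abbrev uFull : FullSituation toyIndex where
  toSituation := uSituation p U
  col := fun _ => uColumn p U
  link := naiveLink

/-- **The typed [IUTchIII] Theorem 3.11 (i) ∧ (ii) ∧ (iii) HOLDS in the value chart, FOR EVERY SCALAR GROUP `U`** (template:
`CandJoshi23.vFull_statement`; none of its clauses reads "Ism"). [folklore] -/
theorem uFull_statement : (uFull p U).Statement := by
  have hI : (uFull p U).PartI := by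
    refine ⟨fun n v hv x _ j => ?_, fun n j a => ⟨fun vQ => ⟨a, rfl⟩, Set.toFinite _, ?_⟩, fun _ _ => rfl⟩
    · show x j ∈ signShells.SubPacket j.1 v
      rw [subPacket_eq_top]; trivial
    · rw [finsum_unique]
      exact (uVol_uHalf p U j.1 _ a).symm
  refine ⟨hI, fun n => ?_, ?_⟩
  · refine (Column.partII_iff _ _).2 ⟨fun m j vQ A hA => ⟨hA, rfl⟩, fun m v hv => rfl, fun m j => rfl, ?_⟩
    refine ⟨fun m m' j vQ _ => uHalf_anti p U (by positivity), fun m j vQ h => absurd trivial h⟩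
  · refine ⟨naiveLink.partIIIa_holds, naiveLink.partIIIb_holds, ?_, ?_,
      (uFull p U).evalCompatUpToInd_of_multiradialCompat hI.2.2⟩
    · refine naiveLink.partIIIc_of_full (fun _ => rfl) fun n m => ?_
      rintro _ ⟨a, rfl⟩
      show unitIso a ≪≫ unitIso ((-1) ^ m.natAbs) = unitIso ((-1) ^ m.natAbs) ≪≫ unitIso a
      rw [unitIso_trans, unitIso_trans, mul_comm]
    · intro n m; exact Thm311.PolyIsoCalc.stabilized_full _ _

/-- Thm. 3.11 (ii) (b) for every column of the value chart over `U`. [folklore] -/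
theorem u_kummerB (n : ℤ) : ((uFull p U).col n).KummerB ((uFull p U).D n) := fun _ _ _ => rfl

/-! ## 3. The hull frame and the setting -/

/-- **The hull frame**: hull-sets the half-lines; «relatively compact» = bounded below; «admits a hull» = a LEAST half-line containing
the set exists. [claim: Mochizuki2012, status: disputed] -/
def uFrame (j : toyIndex.Label) (vQ : toyIndex.VQ) : HullFrame ((uShells p U).Packet j vQ) where
  Hul := {H | ∃ a : ℚ, H = uHalf p U j vQ a}
  IsBounded := fun V => ∃ a : ℚ, V ⊆ uHalf p U j vQ a
  HasHull := fun V => ∃ a : ℚ, V ⊆ uHalf p U j vQ a ∧ ∀ b : ℚ, V ⊆ uHalf p U j vQ b → b ≤ a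
  hul_bounded := by rintro _ ⟨a, rfl⟩; exact ⟨a, subset_rfl⟩
  bounded_mono := fun V V' hVV' ⟨a, ha⟩ => ⟨a, hVV'.trans ha⟩
  exists_hul := fun V ⟨a, ha⟩ => ⟨uHalf p U j vQ a, ⟨a, rfl⟩, ha⟩
  hull_mem := by
    rintro V - ⟨a, hVa, hmax⟩
    refine ⟨a, Set.Subset.antisymm ?_ ?_⟩
    · exact Set.sInter_subset_of_mem ⟨⟨a, rfl⟩, hVa⟩
    · refine Set.subset_sInter ?_
      rintro H ⟨⟨b, rfl⟩, hVb⟩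
      exact uHalf_anti p U (hmax b hVb)

/-- **The setting of the value chart over `U`**: abc-iut-w4-d101's honest object side `pinSig` (pilots of exponent `1`) with HONEST
glue — the `(n,m)`-Kummer image of the lgp-object of exponent `k` at label `j` is `H_{k·j²}`, the image of the `△`-object of exponent
`k` is `H_k` on `𝔽_l^⋇` and `H_0` at the junk label (as `CandJoshi23.valSetting`). [claim: Mochizuki2012, status: disputed] -/
def uSetting : Setting (uSituation p U) where
  n := 0
  HT := ℤ × ℤ
  LogLink := fun _ _ => Unit
  IsFull := fun _ => True
  lattice :=
    { theater := fun n m => (n, m)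
      distinct := fun p q h => by simpa using h
      logLink := fun _ _ => ()
      logLink_full := fun _ _ => trivial }
  Frd := Unit
  IsoF := fun _ _ => Unit
  Ob := fun _ => ℤ
  realify := id
  Strip := Unit
  IsoS := fun _ _ => Unit
  M := fun _ _ => ExpMonoid
  sig := pinSig
  split := { Msplit := fun _ _ => ⊤, exists_gen := fun _ _ => ⟨⟨gen, trivial⟩, top_gen_isGenerator⟩ }
  ObΔ := ℤ
  N := fun _ _ => ExpMonoid
  qData :=
    { q := fun _ _ => gen
      q_gen := fun _ _ => gen_isGenerator
      objOf := fun x => (expOf (x () (Set.mem_univ ())) : ℤ) }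
  frame := fun j vQ => uFrame p U j vQ
  hul_adm := fun _ _ _ hH => hH
  thetaRegionOf := fun _ k j vQ => uHalf p U j vQ ((k : ℚ) * (jsq j : ℚ))
  qRegionOf := fun k j vQ => uHalf p U j vQ (if j = 0 then 0 else (k : ℚ))
  qRegion_mem := fun _ _ => ⟨_, rfl⟩
  qSupport_finite := fun _ => Set.toFinite _

/-- The Θ-pilot object is the lgp-object of exponent `1`. [folklore] -/
theorem uSetting_thetaPilot : (uSetting p U).thetaPilot = (1 : ℤ) :=
  congrArg (Nat.cast : ℕ → ℤ)
    (expOf_eq_one_of_isGenerator_top (Classical.choose_spec ((uSetting p U).split.exists_gen () (Set.mem_univ ()))))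

/-- The q-pilot object is the `△`-object of exponent `1`. [folklore] -/
theorem uSetting_qPilot : (uSetting p U).qPilot = (1 : ℤ) := rfl

/-- The `(n,m)`-Kummer image of the Θ-pilot at label `j` is the honest `H_{j²}` (`H_0` at the junk label). [folklore] -/
theorem uSetting_thetaRegion (m : ℤ) (j : toyIndex.Label) (vQ : toyIndex.VQ) :
    (uSetting p U).thetaRegion m j vQ = uHalf p U j vQ (jsq j : ℚ) := by
  unfold Setting.thetaRegion
  rw [uSetting_thetaPilot]
  show uHalf p U j vQ (((1 : ℤ) : ℚ) * (jsq j : ℚ)) = _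
  rw [Int.cast_one, one_mul]

/-- The q-pilot image at label `j`: the honest `H_1` on `𝔽_l^⋇`, `H_0` at the junk label. [folklore] -/
theorem uSetting_qRegion (j : toyIndex.Label) (vQ : toyIndex.VQ) :
    (uSetting p U).qRegion j vQ = uHalf p U j vQ (if j = 0 then 0 else 1) := by
  show uHalf p U j vQ (if j = 0 then 0 else ((1 : ℤ) : ℚ)) = _
  rw [Int.cast_one]

/-- The (Ind3)-enlarged region at label `j` is `H_{j²}`. [folklore] -/
theorem uSetting_thetaRegion3 (j : toyIndex.Label) (vQ : toyIndex.VQ) :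
    (uSetting p U).thetaRegion3 j vQ = uHalf p U j vQ (jsq j : ℚ) := by
  show (⋃ m : ℤ, (uSetting p U).thetaRegion m j vQ) = _
  simp_rw [uSetting_thetaRegion]
  exact Set.iUnion_const _

/-! ## 4. The region reading and the pins (for `U` inside the positive rationals) -/

/-- **The region reading of the value chart** «`X ↦ {v ≥ X_j}`»: at `j ∈ 𝔽_l^⋇` the half-line above the `j`-components of the tuples of
`X`, at the junk label the unit shell `H_0` (as `CandJoshi23.vRho`). [claim: Mochizuki2012, status: disputed] -/
def uRho (X : ∀ v : toyIndex.V, v ∈ toyIndex.Vbad → Set ((uShells p U).StarPacket v)) (j : toyIndex.Label) (vQ : toyIndex.VQ) :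
    Set ((uShells p U).Packet j vQ) :=
  if h : j = 0 then uHalf p U j vQ 0 else {x | ∃ ψ ∈ X vQ (Set.mem_univ _), line j vQ (ψ ⟨j, h⟩) ≤ line j vQ x}

/-- **(hρ): `uRho` is equivariant under the WHOLE group `⟨(Ind1) ∪ (Ind2)⟩` of the value-chart shells over any `U` INSIDE THE POSITIVE
RATIONALS** — every element acts on each packet line by a scalar of `U` (w4-d098's `actsByScalars_of_mem_closure`), which is positive,
transports `{v ≥ X_j}` and fixes `H_0`. [folklore] -/
theorem uRho_equivariant (hU : U ≤ Units.posSubgroup ℚ) {Φ : (uShells p U).PacketAut}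
    (hΦ : Φ ∈ Subgroup.closure ((uShells p U).Ind1Family ∪ (uShells p U).Ind2Family))
    (X : ∀ v : toyIndex.V, v ∈ toyIndex.Vbad → Set ((uShells p U).StarPacket v)) (j : toyIndex.Label) (vQ : toyIndex.VQ) :
    uRho p U (fun v hv => (uShells p U).starAut Φ v '' X v hv) j vQ = Φ j vQ '' uRho p U X j vQ := by
  obtain ⟨u, hu, hΦc⟩ := (ScalarShells.actsByScalars_of_mem_closure hΦ).scalar j vQ
  have hu0 : (0 : ℚ) < u := (Units.mem_posSubgroup _).1 (hU hu)
  unfold uRho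
  split_ifs with h
  · rw [image_uHalf_of_line_eq p U (Φ j vQ) hu0 hΦc, mul_zero]
  · have h2 : ∀ ψ : (uShells p U).StarPacket vQ,
        line j vQ ((uShells p U).starAut Φ vQ ψ ⟨j, h⟩) = (u : ℚ) * line j vQ (ψ ⟨j, h⟩) := fun ψ => hΦc _
    ext x
    constructor
    · rintro ⟨_, ⟨ψ, hψ, rfl⟩, hx⟩
      refine ⟨(Φ j vQ).symm x, ⟨ψ, hψ, ?_⟩, LinearEquiv.apply_symm_apply _ _⟩
      have h1 := hΦc ((Φ j vQ).symm x)
      rw [LinearEquiv.apply_symm_apply] at h1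
      rw [h2, h1] at hx
      exact le_of_mul_le_mul_left hx hu0
    · rintro ⟨y, ⟨ψ, hψ, hy⟩, rfl⟩
      refine ⟨(uShells p U).starAut Φ vQ ψ, ⟨ψ, hψ, rfl⟩, ?_⟩
      rw [hΦc, h2]
      exact mul_le_mul_of_nonneg_left hy hu0.le

/-- `uRho` on a tuple set all of whose `j`-components have coordinate `c`, and which has an element: the half-line `H_c`. [folklore] -/
theorem uRho_eq_uHalf {j : toyIndex.Label} (hj : j ≠ 0) (vQ : toyIndex.VQ)
    (X : ∀ v : toyIndex.V, v ∈ toyIndex.Vbad → Set ((uShells p U).StarPacket v)) (c : ℚ)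
    (hX : ∀ ψ ∈ X vQ (Set.mem_univ _), line j vQ (ψ ⟨j, hj⟩) = c) {ψ₀ : (uShells p U).StarPacket vQ}
    (hψ₀ : ψ₀ ∈ X vQ (Set.mem_univ _)) : uRho p U X j vQ = uHalf p U j vQ c := by
  unfold uRho
  rw [dif_neg hj]
  ext x
  constructor
  · rintro ⟨ψ, hψ, hx⟩
    rw [mem_uHalf, ← hX ψ hψ]
    exact hx
  · intro hx
    exact ⟨ψ₀, hψ₀, by rw [hX ψ₀ hψ₀]; exact hx⟩

/-- `uRho` on the Θ-tuple datum: the honest `H_{j²}` at every label (`H_0` at the junk label). [folklore] -/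
theorem uRho_uPsi (j : toyIndex.Label) (vQ : toyIndex.VQ) :
    uRho p U (fun v _ => uPsi p U v) j vQ = uHalf p U j vQ (jsq j : ℚ) := by
  by_cases h : j = 0
  · subst h; unfold uRho; rw [dif_pos rfl, CandJoshi23.jsq_zero_cast]
  · exact uRho_eq_uHalf p U h vQ _ _ (fun ψ hψ => hψ ⟨j, h⟩) (uThetaTuple_mem p U vQ)

/-- `uRho` on the q-pilot's Kummer datum: the honest `H_1` on `𝔽_l^⋇`, `H_0` at the junk label. [folklore] -/
theorem uRho_uQDatum (j : toyIndex.Label) (vQ : toyIndex.VQ) :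
    uRho p U (uQDatum p U) j vQ = uHalf p U j vQ (if j = 0 then 0 else 1) := by
  by_cases h : j = 0
  · subst h; unfold uRho; rw [dif_pos rfl, if_pos rfl]
  · rw [if_neg h]; exact uRho_eq_uHalf p U h vQ _ _ (fun ψ hψ => hψ ⟨j, h⟩) (uQTuple_mem p U vQ)

/-- **(hρ) ∧ (pΘ) — the Θ-pilot pin HOLDS** in the value chart over every `U` inside the positive rationals. [claim: Mochizuki2012, status: disputed] -/
theorem u_thetaPinned (hU : U ≤ Units.posSubgroup ℚ) :
    ThetaPinned (uFull p U).toLatticeSituation (uSetting p U) (uRho p U) := by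
  refine ⟨fun Φ hΦ X j vQ => uRho_equivariant p U hU hΦ X j vQ, fun m j vQ => ?_⟩
  show (uSetting p U).thetaRegion m j vQ = uRho p U (fun v _ => uPsi p U v) j vQ
  rw [uRho_uPsi, uSetting_thetaRegion]

/-- **(pq′) — the q-pilot pin HOLDS** for the honest Kummer datum `uQDatum` (every `U`). [claim: Mochizuki2012, status: disputed] -/
theorem u_qPinned : QPinned (uFull p U).toLatticeSituation (uSetting p U) (uRho p U) (uQDatum p U) := fun j vQ => by
  rw [uSetting_qRegion, uRho_uQDatum]

/-- **(pL) — the link pin HOLDS** (identity of exponents, pilots of exponent `1`; every `U`). [folklore] -/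
theorem u_linkPinned : LinkPinned (uFull p U).toLatticeSituation (uSetting p U) :=
  ⟨Equiv.refl ℤ, by rw [uSetting_thetaPilot, uSetting_qPilot]; rfl⟩

/-- **`PinnedRegions3` HOLDS in the value chart over every `U` inside the positive rationals.** [claim: Mochizuki2012, status: disputed] -/
theorem u_pinnedRegions3 (hU : U ≤ Units.posSubgroup ℚ) :
    PinnedRegions3 (uFull p U).toLatticeSituation (uSetting p U) (uRho p U) (uQDatum p U) :=
  ⟨⟨u_thetaPinned p U hU, u_qPinned p U⟩, u_linkPinned p U⟩

end Summit.ABC.IUTFork.Repair.CandJoshi24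

end
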